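import Summits.KontsevichZagierPeriods.KontsevichZagierPeriods.Theses.ZeroPortrait
import Summits.KontsevichZagierPeriods.KontsevichZagierPeriods.Theorems.FurushoPentagonSectorToKernelCubeResolutionOfNash
import Summits.KontsevichZagierPeriods.KontsevichZagierPeriods.Theorems.HurwitzMicroSectorsNormalFormPrincipleSplitGlue
import Summits.KontsevichZagierPeriods.KontsevichZagierPeriods.Theorems.TerasomaMultiplicationBetaCancellationOfAyoubPiCancellation
import Literature.NumberTheory.Transcendental.KZCalculusProofs
import Literature.NumberTheory.Transcendental.KZKernelConjectureForms
import Literature.NumberTheory.Transcendental.KZProductIdeal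

/-!
# Line `ayoub-pi-split` on crux `ZeroPortrait.PencilComplete` (stmt-KontsevichZagierPeriods-11731):
the AYOUB–π SPLIT modulo the pencil sector — three registered stubs (= the three leaves of the
split) and the kernel-checked composition `PencilComplete_of` concluding the crux BY NAME
(honesty certificates — summit ⇒ X, X ⇔ kernel form, X ⇒ leaf 2, X ⇒ leaf 3 — live in
`Cruxes/PencilComplete/AyoubPiSplit.lean`, not here, so that exactly the composition concludes the crux)

Crux strategist `cstrat-stmt-KontsevichZagierPeriods-11731-r1` (RESTATED deciding-crux re-audit,
BC2 redirect, 2026-08-17). The crux `X = PencilComplete` of route ZeroPortrait is Conjecture 1 of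
Kontsevich–Zagier (KZ-literal rational endpoints) RELATIVE to the two pencils of the route:
`[ρ] − [ρ'] ∈ pencilSector := relations ⊔ closure(equal-valued Legendre-pencil pairs) ⊔
closure(equal-valued beta-pencil pairs)`. It is summit-implied (`pencilComplete_of_summit`) and
equivalent to its kernel form `ker eval ≤ pencilSector` (`pencilComplete_iff_kernelForm`: the
rational shape is not load-bearing). The same absorption phenomena as for the sibling sector cruxes
(`TerasomaMultiplication.CompleteModGammaSector`, `Grothendieck.SectorComplement`) forbid sector /
residual / dimension / volume / degree cuts; what survives is the product of the two classical
factorisations of the period conjecture, written inside the calculus of moves and taken modulo the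
pencil sector:

* **normal form** (Ayoub 2014, Rem. 12–13; Huber–Müller-Stach 2017, Lemma 11.2.3): pass to
  `ℤ`-combinations of TAME CUBE classes `[[0,1]ⁿ, g]`, `g` analytic near the closed cube — leaf 1
  `CubeNashNormalForm`, VERBATIM the existing item stmt-KontsevichZagierPeriods-3574 (route
  LiftingCriteria; summit-free geometry: Nash cells + rectilinearisation; dim ≤ 1 landed);
* **localisation at `[π]`** (Kontsevich–Zagier 2001 §4.1; Ayoub 2014 Conj. 7; Huber–Wüstholz 2022
  App. A.4): leaf 2 `CubicalPiLocalKernelModPencils` — Ayoub's effective cube kernel LOCALISED at the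
  disc class and taken modulo the pencil sector (the statement on which torsor / motivic-Galois
  methods act at all, stated on the classes where a period symbol can be defined without
  resolution), and leaf 3 `PiCancellationModPencils` — the disc class is a non-zero-divisor modulo
  `pencilSector` (item 0540 with `relations ↦ pencilSector`; transcendence-free; its motivic shadow
  `P̃(MM^eff) → P̃(MM)` injective is printed OPEN, Huber–Wüstholz 2022 App. A.4).

Composition `PencilComplete_of` (PROVED modulo the three stubs; the same proof is the sorry-free assembly `pencilComplete_of_ayoubPiSplit` of `AyoubPiSplit.lean`): rational pair of equal value →
`c = [ρ] − [ρ']` with `eval c = 0` → cubical resolution of `c` from leaf 1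
(`SectorToKernel.cubeResolution_of_cubeNashNormalForm`, landed) → a value-zero element `a` of the
cubical span (soundness) → a pinned disc-product operator EXISTS
(`NormalFormPrincipleSplitGlue.exists_pinnedProduct`, landed; nothing is consumed vacuously) →
leaf 2 gives `[π]^N a ∈ pencilSector` → leaf 3 peels the `N` disc factors (induction) →
`c ∈ pencilSector`. Each leaf is load-bearing; none is `X` or the summit by a cheap probe
(`bc/*_probe.lean` in the strategist folder, 6/6 fail); none carries a landed `iff` with `X` or the
summit; leaves 2 and 3 are `X`-implied (`cubicalPiLocalKernelModPencils_of_crux`,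
`piCancellationModPencils_of_crux`), leaf 1 is summit-free geometry; given leaf 1 the split is
EXACT (`pencilComplete_iff_piSplit_of_cubeNash`).

References: Kontsevich–Zagier 2001 §1.2, §4.1; Ayoub, EMS Newsl. 91 (2014) Def. 9–10, Prop. 11,
Rem. 12–13, Conj. 7; Huber–Wüstholz 2022 App. A.4; Huber–Müller-Stach 2017 Lemma 11.2.3,
Rem. 13.1.8.
-/

noncomputable section

set_option linter.dupNamespace false

namespace Summit.KontsevichZagierPeriods.KontsevichZagierPeriods.Cruxes.PencilComplete.AyoubPiSplitLine

open MeasureTheory Set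
open Literature.NumberTheory.Transcendental
open Literature.NumberTheory.Transcendental.KZ hiding cubicalSpan
open Summit.KontsevichZagierPeriods.KontsevichZagierPeriods.Theses.ZeroPortrait (PencilComplete)
open Summit.KontsevichZagierPeriods.FurushoPentagon.ReducedPeriodRing (cubicalGens cubicalSpan)
open Summit.KontsevichZagierPeriods.FurushoPentagon.SectorToKernel (cubeResolution_of_cubeNashNormalForm)
open Summit.KontsevichZagierPeriods.HurwitzMicroSectors.NormalFormPrincipleSplitGlue (exists_pinnedProduct)
open Summit.KontsevichZagierPeriods.KontsevichZagierPeriods.BetaCancellationLine (piRep_mul_sub_lift_mem_relations)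

/-! ## The three leaves, verbatim as filed (route-file vocabulary only: the pencil sector and the
tame-cube generators are inlined; the disc product is pinned as in items 0540/0541) -/

/-- **Leaf 1 — cube-Nash normal form** = item stmt-KontsevichZagierPeriods-3574
(`LiftingCriteria.CubeNashNormalForm`) VERBATIM. Summit-free geometry.
[cite: Ayoub2014, Rem. 12] [cite: HuberMullerStachPeriods2017, Lemma 11.2.3] -/
def CubeNashNormalForm : Prop :=
  ∀ (k k' : ℕ) (r : Literature.NumberTheory.Transcendental.KZ.IntegralRep k) (r' : Literature.NumberTheory.Transcendental.KZ.IntegralRep k'), r.IsRational → r'.IsRational → ∃ (S : ℕ) (n : Fin S → ℕ) (g : (i : Fin S) → (Fin (n i) → ℝ) → ℝ) (U : (i : Fin S) → Set (Fin (n i) → ℝ)) (ε : Fin S → ℤ) (s : (i : Fin S) → Literature.NumberTheory.Transcendental.KZ.IntegralRep (n i)), (∀ i, IsOpen (U i) ∧ Set.pi Set.univ (fun _ : Fin (n i) => Set.Icc (0:ℝ) 1) ⊆ (U i) ∧ Literature.NumberTheory.Transcendental.IsSemialgebraicFunOn ℚ (U i) (g i) ∧ AnalyticOnNhd ℝ (g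 i) (U i)) ∧ (∀ i, (s i).domain = Set.pi Set.univ (fun _ : Fin (n i) => Set.Icc (0:ℝ) 1) ∧ ∀ z ∈ Set.pi Set.univ (fun _ : Fin (n i) => Set.Icc (0:ℝ) 1), (s i).integrand z = g i z) ∧ Literature.NumberTheory.Transcendental.KZ.of r - Literature.NumberTheory.Transcendental.KZ.of r' - ∑ i, ε i • Literature.NumberTheory.Transcendental.KZ.of (s i) ∈ Literature.NumberTheory.Transcendental.KZ.relations

/-- **Leaf 2 — Ayoub's effective cube kernel, localised at `[π]`, modulo the pencil sector.**
[cite: Ayoub2014, Conj. 7] [cite: KontsevichZagier2001, §4.1] -/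
def CubicalPiLocalKernelModPencils : Prop :=
  ∀ (P : ∀ n : ℕ, Literature.NumberTheory.Transcendental.KZ.IntegralRep n → Literature.NumberTheory.Transcendental.KZ.IntegralRep (n + 2)), (∀ (n : ℕ) (r : Literature.NumberTheory.Transcendental.KZ.IntegralRep n), (P n r).domain = {z : Fin (n + 2) → ℝ | z 0 ^ 2 + z 1 ^ 2 ≤ 1 ∧ (fun i : Fin n => z i.succ.succ) ∈ r.domain} ∧ (P n r).integrand = fun z => r.integrand (fun i : Fin n => z i.succ.succ)) → ∀ a ∈ AddSubgroup.closure {d : Literature.NumberTheory.Transcendental.KZ.FormalRep | ∃ (n : ℕ) (ρ : Literature.NumberTheory.Transcendental.KZ.IntegralRep n), ρ.domain = {x | ∀ i, 0 ≤ x i ∧ x i ≤ 1} ∧ AnalyticOnNhd ℝ ρ.integrand {x | ∀ i, 0 ≤ x i ∧ x i ≤ 1} ∧ d = Literature.NumberTheory.Transcendental.KZ.of ρ}, Literature.NumberTheory.Transcendental.KZ.eval a = 0 → ∃ N : ℕ, (⇑(FreeAbelianGroup.lift (fun s : (Σ n, Literature.NumberTheory.Transcendental.KZ.IntegralRep n)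 => Literature.NumberTheory.Transcendental.KZ.of (P s.1 s.2))))^[N] a ∈ (Literature.NumberTheory.Transcendental.KZ.relations ⊔ AddSubgroup.closure {d | ∃ (a b c s : ℚ) (r : Literature.NumberTheory.Transcendental.KZ.IntegralRep 2) (r' : Literature.NumberTheory.Transcendental.KZ.IntegralRep 1), 0 < s ∧ s < 1 ∧ r.domain = {x | ∀ i, x i ∈ Set.Ioo (0:ℝ) 1} ∧ Set.EqOn r.integrand (fun x => (a : ℝ) * (1 / Real.sqrt ((1 - x 0 ^ 2) * (1 - (s : ℝ) * x 0 ^ 2)) * (1 / Real.sqrt ((1 - x 1 ^ 2) * (1 - (s : ℝ) * x 1 ^ 2)))) + (b : ℝ) * (Real.sqrt (1 - (s : ℝ) * x 0 ^ 2) / Real.sqrt (1 - x 0 ^ 2) * (1 / Real.sqrt ((1 - x 1 ^ 2) * (1 - (s : ℝ) * x 1 ^ 2)))) + (c : ℝ) * (Real.sqrt (1 - (s : ℝ) * x 0 ^ 2) / Real.sqrt (1 - x 0 ^ 2) * (Real.sqrt (1 - (s : ℝ) * x 1 ^ 2) / Real.sqrt (1 - x 1 ^ 2)))) r.domain ∧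 r'.domain = Set.univ ∧ Set.EqOn r'.integrand (fun x => 1 / (2 * (1 + x 0 ^ 2))) r'.domain ∧ r.value = r'.value ∧ d = Literature.NumberTheory.Transcendental.KZ.of r - Literature.NumberTheory.Transcendental.KZ.of r'} ⊔ AddSubgroup.closure {d | ∃ (s : ℚ) (r r' : Literature.NumberTheory.Transcendental.KZ.IntegralRep 2), 0 < s ∧ r.domain = {x | ∀ i, x i ∈ Set.Ioo (0:ℝ) 1} ∧ Set.EqOn r.integrand (fun x => (x 0) ^ ((s : ℝ) - 1) * (1 - x 0) ^ (-(5:ℝ)/9) * (x 1) ^ (-(4:ℝ)/9) * (1 - x 1) ^ (-(2:ℝ)/9)) r.domain ∧ r'.domain = {x | x 0 ^ 2 + x 1 ^ 2 < 4} ∧ Set.EqOn r'.integrand (fun _ => (3:ℝ) ^ ((7:ℝ)/6) / 2) r'.domain ∧ r.value = r'.value ∧ d = Literature.NumberTheory.Transcendental.KZ.of r - Literature.NumberTheory.Transcendental.KZ.of r'})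

/-- **Leaf 3 — `[π]`-cancellation modulo the pencil sector** (item 0540 with `relations ↦
pencilSector`). [cite: HuberWustholz2022, App. A.4] [cite: Ayoub2014, Conj. 7] -/
def PiCancellationModPencils : Prop :=
  ∀ (P : ∀ n : ℕ, Literature.NumberTheory.Transcendental.KZ.IntegralRep n → Literature.NumberTheory.Transcendental.KZ.IntegralRep (n + 2)), (∀ (n : ℕ) (r : Literature.NumberTheory.Transcendental.KZ.IntegralRep n), (P n r).domain = {z : Fin (n + 2) → ℝ | z 0 ^ 2 + z 1 ^ 2 ≤ 1 ∧ (fun i : Fin n => z i.succ.succ) ∈ r.domain} ∧ (P n r).integrand = fun z => r.integrand (fun i : Fin n => z i.succ.succ)) → ∀ c : Literature.NumberTheory.Transcendental.KZ.FormalRep, FreeAbelianGroup.lift (fun s : (Σ n, Literature.NumberTheory.Transcendental.KZ.IntegralRep n) => Literature.NumberTheory.Transcendental.KZ.of (P s.1 s.2)) c ∈ (Literature.NumberTheory.Transcendental.KZ.relations ⊔ AddSubgroup.closure {d | ∃ (a b c s : ℚ) (r : Literature.NumberTheory.Transcendental.KZ.IntegralRep 2) (r' : Literature.NumberTheory.Transcendental.KZ.IntegralRep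 1), 0 < s ∧ s < 1 ∧ r.domain = {x | ∀ i, x i ∈ Set.Ioo (0:ℝ) 1} ∧ Set.EqOn r.integrand (fun x => (a : ℝ) * (1 / Real.sqrt ((1 - x 0 ^ 2) * (1 - (s : ℝ) * x 0 ^ 2)) * (1 / Real.sqrt ((1 - x 1 ^ 2) * (1 - (s : ℝ) * x 1 ^ 2)))) + (b : ℝ) * (Real.sqrt (1 - (s : ℝ) * x 0 ^ 2) / Real.sqrt (1 - x 0 ^ 2) * (1 / Real.sqrt ((1 - x 1 ^ 2) * (1 - (s : ℝ) * x 1 ^ 2)))) + (c : ℝ) * (Real.sqrt (1 - (s : ℝ) * x 0 ^ 2) / Real.sqrt (1 - x 0 ^ 2) * (Real.sqrt (1 - (s : ℝ) * x 1 ^ 2) / Real.sqrt (1 - x 1 ^ 2)))) r.domain ∧ r'.domain = Set.univ ∧ Set.EqOn r'.integrand (fun x => 1 / (2 * (1 + x 0 ^ 2))) r'.domain ∧ r.value = r'.value ∧ d = Literature.NumberTheory.Transcendental.KZ.of r - Literature.NumberTheory.Transcendental.KZ.of r'} ⊔ AddSubgroup.closure {d | ∃ (s : ℚ) (r r' : Literature.NumberTheory.Transcendental.KZ.IntegralRep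 2), 0 < s ∧ r.domain = {x | ∀ i, x i ∈ Set.Ioo (0:ℝ) 1} ∧ Set.EqOn r.integrand (fun x => (x 0) ^ ((s : ℝ) - 1) * (1 - x 0) ^ (-(5:ℝ)/9) * (x 1) ^ (-(4:ℝ)/9) * (1 - x 1) ^ (-(2:ℝ)/9)) r.domain ∧ r'.domain = {x | x 0 ^ 2 + x 1 ^ 2 < 4} ∧ Set.EqOn r'.integrand (fun _ => (3:ℝ) ^ ((7:ℝ)/6) / 2) r'.domain ∧ r.value = r'.value ∧ d = Literature.NumberTheory.Transcendental.KZ.of r - Literature.NumberTheory.Transcendental.KZ.of r'}) → c ∈ (Literature.NumberTheory.Transcendental.KZ.relations ⊔ AddSubgroup.closure {d | ∃ (a b c s : ℚ) (r : Literature.NumberTheory.Transcendental.KZ.IntegralRep 2) (r' : Literature.NumberTheory.Transcendental.KZ.IntegralRep 1), 0 < s ∧ s < 1 ∧ r.domain = {x | ∀ i, x i ∈ Set.Ioo (0:ℝ) 1} ∧ Set.EqOn r.integrand (fun x => (a : ℝ) * (1 / Real.sqrt ((1 - x 0 ^ 2) * (1 - (s : ℝ) * x 0 ^ 2)) * (1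 / Real.sqrt ((1 - x 1 ^ 2) * (1 - (s : ℝ) * x 1 ^ 2)))) + (b : ℝ) * (Real.sqrt (1 - (s : ℝ) * x 0 ^ 2) / Real.sqrt (1 - x 0 ^ 2) * (1 / Real.sqrt ((1 - x 1 ^ 2) * (1 - (s : ℝ) * x 1 ^ 2)))) + (c : ℝ) * (Real.sqrt (1 - (s : ℝ) * x 0 ^ 2) / Real.sqrt (1 - x 0 ^ 2) * (Real.sqrt (1 - (s : ℝ) * x 1 ^ 2) / Real.sqrt (1 - x 1 ^ 2)))) r.domain ∧ r'.domain = Set.univ ∧ Set.EqOn r'.integrand (fun x => 1 / (2 * (1 + x 0 ^ 2))) r'.domain ∧ r.value = r'.value ∧ d = Literature.NumberTheory.Transcendental.KZ.of r - Literature.NumberTheory.Transcendental.KZ.of r'} ⊔ AddSubgroup.closure {d | ∃ (s : ℚ) (r r' : Literature.NumberTheory.Transcendental.KZ.IntegralRep 2), 0 < s ∧ r.domain = {x | ∀ i, x i ∈ Set.Ioo (0:ℝ) 1} ∧ Set.EqOn r.integrand (fun x => (x 0) ^ ((s : ℝ) - 1) * (1 - x 0) ^ (-(5:ℝ)/9)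 * (x 1) ^ (-(4:ℝ)/9) * (1 - x 1) ^ (-(2:ℝ)/9)) r.domain ∧ r'.domain = {x | x 0 ^ 2 + x 1 ^ 2 < 4} ∧ Set.EqOn r'.integrand (fun _ => (3:ℝ) ^ ((7:ℝ)/6) / 2) r'.domain ∧ r.value = r'.value ∧ d = Literature.NumberTheory.Transcendental.KZ.of r - Literature.NumberTheory.Transcendental.KZ.of r'})

/-! ## Registered stubs of the LINE `ayoub-pi-split` (the three leaves of the split, each its own item
after `route edit --split`; sorries live ONLY here). Birth skeletons one level down:
`Lines/CubeNashNormalForm_birth.lean`, `Lines/CubicalPiLocalKernelModPencils_birth.lean`,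
`Lines/PiCancellationModPencils_birth.lean`. -/

/-- **Stub 1 = leaf 1** (item stmt-KontsevichZagierPeriods-3574 verbatim; summit-free geometry, XL). -/
theorem stub_cubeNashNormalForm : CubeNashNormalForm := by
  sorry

/-- **Stub 2 = leaf 2** (Ayoub's effective cube kernel, localised at `[π]`, modulo the pencils). HARDEST:
the transcendence core. -/
theorem stub_cubicalPiLocalKernelModPencils : CubicalPiLocalKernelModPencils := by
  sorry

/-- **Stub 3 = leaf 3** (`[π]`-cancellation modulo the pencils; item 0540 with `relations ↦ pencilSector`). -/
theorem stub_piCancellationModPencils : PiCancellationModPencils := by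
  sorry

/-! ### Names for the three statements (hypotheses of the composition)
The skeleton audit admits, as hypotheses of the theorem that concludes the crux, only registered obligations or
the declared stubs BY NAME; `Statement.stub_x` is the statement of `stub_x` under the stub's own short name. -/
namespace Statement

/-- Statement of `stub_cubeNashNormalForm` (leaf 1). -/
abbrev stub_cubeNashNormalForm : Prop := type_of% AyoubPiSplitLine.stub_cubeNashNormalForm

/-- Statement of `stub_cubicalPiLocalKernelModPencils` (leaf 2). -/
abbrev stub_cubicalPiLocalKernelModPencils : Prop := type_of% AyoubPiSplitLine.stub_cubicalPiLocalKernelModPencils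

/-- Statement of `stub_piCancellationModPencils` (leaf 3). -/
abbrev stub_piCancellationModPencils : Prop := type_of% AyoubPiSplitLine.stub_piCancellationModPencils

end Statement

/-! ## Bridges: the inlined vocabulary, named -/

/-- Equal-valued Legendre-pencil pair differences (route ZeroPortrait, verbatim). [folklore] -/
def legendrePairs : Set FormalRep :=
  {d | ∃ (a b c s : ℚ) (r : Literature.NumberTheory.Transcendental.KZ.IntegralRep 2) (r' : Literature.NumberTheory.Transcendental.KZ.IntegralRep 1), 0 < s ∧ s < 1 ∧ r.domain = {x | ∀ i, x i ∈ Set.Ioo (0:ℝ) 1} ∧ Set.EqOn r.integrand (fun x => (a : ℝ) * (1 / Real.sqrt ((1 - x 0 ^ 2) * (1 - (s : ℝ) * x 0 ^ 2)) * (1 / Real.sqrt ((1 - x 1 ^ 2) * (1 - (s : ℝ) * x 1 ^ 2)))) + (b : ℝ) * (Real.sqrt (1 - (s : ℝ) * x 0 ^ 2) / Real.sqrt (1 - x 0 ^ 2) * (1 / Real.sqrt ((1 - x 1 ^ 2) * (1 - (s : ℝ) * x 1 ^ 2)))) + (c : ℝ) * (Real.sqrt (1 - (s : ℝ) * x 0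 ^ 2) / Real.sqrt (1 - x 0 ^ 2) * (Real.sqrt (1 - (s : ℝ) * x 1 ^ 2) / Real.sqrt (1 - x 1 ^ 2)))) r.domain ∧ r'.domain = Set.univ ∧ Set.EqOn r'.integrand (fun x => 1 / (2 * (1 + x 0 ^ 2))) r'.domain ∧ r.value = r'.value ∧ d = Literature.NumberTheory.Transcendental.KZ.of r - Literature.NumberTheory.Transcendental.KZ.of r'}

/-- Equal-valued beta-pencil pair differences (route ZeroPortrait, verbatim). [folklore] -/
def betaPairs : Set FormalRep :=
  {d | ∃ (s : ℚ) (r r' : Literature.NumberTheory.Transcendental.KZ.IntegralRep 2), 0 < s ∧ r.domain = {x | ∀ i, x i ∈ Set.Ioo (0:ℝ) 1} ∧ Set.EqOn r.integrand (fun x => (x 0) ^ ((s : ℝ) - 1) * (1 - x 0) ^ (-(5:ℝ)/9) * (x 1) ^ (-(4:ℝ)/9) * (1 - x 1) ^ (-(2:ℝ)/9)) r.domain ∧ r'.domain = {x | x 0 ^ 2 + x 1 ^ 2 < 4} ∧ Set.EqOn r'.integrand (fun _ => (3:ℝ) ^ ((7:ℝ)/6) / 2) r'.domain ∧ r.value =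 r'.value ∧ d = Literature.NumberTheory.Transcendental.KZ.of r - Literature.NumberTheory.Transcendental.KZ.of r'}

/-- The pencil sector `relations ⊔ closure legendrePairs ⊔ closure betaPairs`. [folklore] -/
def pencilSector : AddSubgroup FormalRep :=
  relations ⊔ AddSubgroup.closure legendrePairs ⊔ AddSubgroup.closure betaPairs

/-- The inlined sector is `pencilSector`. [folklore] -/
theorem inlinedSector_eq :
    (Literature.NumberTheory.Transcendental.KZ.relations ⊔ AddSubgroup.closure {d | ∃ (a b c s : ℚ) (r : Literature.NumberTheory.Transcendental.KZ.IntegralRep 2) (r' : Literature.NumberTheory.Transcendental.KZ.IntegralRep 1), 0 < s ∧ s < 1 ∧ r.domain = {x | ∀ i, x i ∈ Set.Ioo (0:ℝ) 1} ∧ Set.EqOn r.integrand (fun x => (a : ℝ) * (1 / Real.sqrt ((1 - x 0 ^ 2) * (1 - (s : ℝ) * x 0 ^ 2)) * (1 / Real.sqrt ((1 - x 1 ^ 2) * (1 - (s : ℝ) * x 1 ^ 2)))) + (b : ℝ) * (Real.sqrt (1 - (s : ℝ) * x 0 ^ 2) / Real.sqrt (1 - x 0 ^ 2) * (1 / Real.sqrt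 ((1 - x 1 ^ 2) * (1 - (s : ℝ) * x 1 ^ 2)))) + (c : ℝ) * (Real.sqrt (1 - (s : ℝ) * x 0 ^ 2) / Real.sqrt (1 - x 0 ^ 2) * (Real.sqrt (1 - (s : ℝ) * x 1 ^ 2) / Real.sqrt (1 - x 1 ^ 2)))) r.domain ∧ r'.domain = Set.univ ∧ Set.EqOn r'.integrand (fun x => 1 / (2 * (1 + x 0 ^ 2))) r'.domain ∧ r.value = r'.value ∧ d = Literature.NumberTheory.Transcendental.KZ.of r - Literature.NumberTheory.Transcendental.KZ.of r'} ⊔ AddSubgroup.closure {d | ∃ (s : ℚ) (r r' : Literature.NumberTheory.Transcendental.KZ.IntegralRep 2), 0 < s ∧ r.domain = {x | ∀ i, x i ∈ Set.Ioo (0:ℝ) 1} ∧ Set.EqOn r.integrand (fun x => (x 0) ^ ((s : ℝ) - 1) * (1 - x 0) ^ (-(5:ℝ)/9) * (x 1) ^ (-(4:ℝ)/9) * (1 - x 1) ^ (-(2:ℝ)/9)) r.domain ∧ r'.domain = {x | x 0 ^ 2 + x 1 ^ 2 < 4} ∧ Set.EqOn r'.integrand (fun _ => (3:ℝ) ^ ((7:ℝ)/6)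 / 2) r'.domain ∧ r.value = r'.value ∧ d = Literature.NumberTheory.Transcendental.KZ.of r - Literature.NumberTheory.Transcendental.KZ.of r'}) = pencilSector := rfl

/-- Leaf 1 is item 3574 on the nose. [folklore] -/
theorem cubeNashNormalForm_iff :
    CubeNashNormalForm ↔
      Summit.KontsevichZagierPeriods.KontsevichZagierPeriods.Theses.LiftingCriteria.CubeNashNormalForm :=
  Iff.rfl

/-- The crux, unfolded through the bridge. [folklore] -/
theorem pencilComplete_iff :
    PencilComplete ↔ ∀ ⦃n m : ℕ⦄ (ρ : IntegralRep n) (ρ' : IntegralRep m), ρ.IsRational → ρ'.IsRational →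
      ρ.value = ρ'.value → of ρ - of ρ' ∈ pencilSector :=
  Iff.rfl

/-- The pinning hypothesis of items 0540/0541, as a predicate on operators `P`. [folklore] -/
def IsPinnedDisc (P : ∀ n : ℕ, IntegralRep n → IntegralRep (n + 2)) : Prop :=
  ∀ (n : ℕ) (r : IntegralRep n), (P n r).domain = {z : Fin (n + 2) → ℝ | z 0 ^ 2 + z 1 ^ 2 ≤ 1 ∧
    (fun i : Fin n => z i.succ.succ) ∈ r.domain} ∧
    (P n r).integrand = fun z => r.integrand (fun i : Fin n => z i.succ.succ)

/-- The additive extension `[r] ↦ [P r]` of a pinned operator to formal combinations. [folklore] -/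
def liftP (P : ∀ n : ℕ, IntegralRep n → IntegralRep (n + 2)) : FormalRep →+ FormalRep :=
  FreeAbelianGroup.lift (fun s : (Σ n, IntegralRep n) => of (P s.1 s.2))

/-- Leaf 2, unfolded through the bridges. [folklore] -/
theorem cubicalPiLocalKernelModPencils_iff :
    CubicalPiLocalKernelModPencils ↔
      ∀ P, IsPinnedDisc P → ∀ a ∈ cubicalSpan, eval a = 0 → ∃ N : ℕ, (liftP P)^[N] a ∈ pencilSector :=
  Iff.rfl

/-- Leaf 3, unfolded through the bridges. [folklore] -/
theorem piCancellationModPencils_iff :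
    PiCancellationModPencils ↔
      ∀ P, IsPinnedDisc P → ∀ c : FormalRep, liftP P c ∈ pencilSector → c ∈ pencilSector :=
  Iff.rfl

/-- `relations ≤ pencilSector`. [folklore] -/
theorem relations_le_pencilSector : relations ≤ pencilSector :=
  le_sup_left.trans le_sup_left

/-! ## The assembly -/

/-- Peeling: under `[π]`-cancellation modulo the pencils, `[π]^N x ∈ pencilSector` forces
`x ∈ pencilSector`. [folklore] -/
theorem mem_pencilSector_of_iterate_mem {P : ∀ n : ℕ, IntegralRep n → IntegralRep (n + 2)}
    (hcanc : ∀ c : FormalRep, liftP P c ∈ pencilSector → c ∈ pencilSector) :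
    ∀ (N : ℕ) (x : FormalRep), (liftP P)^[N] x ∈ pencilSector → x ∈ pencilSector
  | 0, _, h => h
  | N + 1, x, h => by
    rw [Function.iterate_succ_apply'] at h
    exact mem_pencilSector_of_iterate_mem hcanc N x (hcanc _ h)

/-- **Cubical resolution of a formal combination** (leaf 1 + the landed
`cubeResolution_of_cubeNashNormalForm` + `exists_integralRep_sub`): every formal combination is
congruent modulo the KZ relations to an element of the cubical span. [cite: Ayoub2014, Rem. 12] -/
theorem exists_cubical_of_cubeNashNormalForm (h₁ : CubeNashNormalForm) (c : FormalRep) :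
    ∃ a ∈ cubicalSpan, c - a ∈ relations := by
  obtain ⟨n, m, r, r', hrel⟩ := exists_integralRep_sub_holds c
  obtain ⟨a₁, ha₁, h1⟩ := cubeResolution_of_cubeNashNormalForm (cubeNashNormalForm_iff.mp h₁) n r
  obtain ⟨a₂, ha₂, h2⟩ := cubeResolution_of_cubeNashNormalForm (cubeNashNormalForm_iff.mp h₁) m r'
  refine ⟨a₁ - a₂, cubicalSpan.sub_mem ha₁ ha₂, ?_⟩
  have : c - (a₁ - a₂) = (c - (of r - of r')) + (of r - a₁) - (of r' - a₂) := by abel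
  rw [this]
  exact relations.sub_mem (relations.add_mem hrel h1) h2

/-- **THE COMPOSITION (= the assembly of the split), concluding the crux BY NAME.** Cube-Nash normal form (leaf 1), Ayoub's localised cube kernel modulo the
pencils (leaf 2) and `[π]`-cancellation modulo the pencils (leaf 3) imply `PencilComplete`.
[cite: Ayoub2014, Rem. 12–13 and Conj. 7] [cite: KontsevichZagier2001, §1.2 and §4.1] -/
theorem PencilComplete_of (h₁ : Statement.stub_cubeNashNormalForm)
    (h₂ : Statement.stub_cubicalPiLocalKernelModPencils) (h₃ : Statement.stub_piCancellationModPencils) :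
    Summit.KontsevichZagierPeriods.KontsevichZagierPeriods.Theses.ZeroPortrait.PencilComplete := by
  rw [pencilComplete_iff]
  intro n m ρ ρ' _ _ hv
  -- the formal difference evaluates to zero
  have hc0 : eval (of ρ - of ρ') = 0 := by rw [eval_of_sub_of, hv, sub_self]
  -- a pinned disc-product operator exists (landed construction): the leaves are not consumed vacuously
  obtain ⟨P, hP⟩ := exists_pinnedProduct
  have hP' : IsPinnedDisc P := hP
  -- leaf 1: reduce `[ρ] − [ρ']` to the cubical span
  obtain ⟨a, ha, hca⟩ := exists_cubical_of_cubeNashNormalForm h₁ (of ρ - of ρ')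
  -- soundness: the cubical representative still evaluates to zero
  have ha0 : eval a = 0 := by
    have h := relations_le_ker_eval_holds hca
    rw [AddMonoidHom.mem_ker, map_sub, hc0, zero_sub, neg_eq_zero] at h
    exact h
  -- leaf 2: some disc power of `a` lies in the pencil sector
  obtain ⟨N, hN⟩ := (cubicalPiLocalKernelModPencils_iff.mp h₂) P hP' a ha ha0
  -- leaf 3: peel the disc factors
  have haS : a ∈ pencilSector :=
    mem_pencilSector_of_iterate_mem ((piCancellationModPencils_iff.mp h₃) P hP') N a hN
  -- conclude: `[ρ] − [ρ'] = ([ρ] − [ρ'] − a) + a`, `relations ≤ pencilSector`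
  have : of ρ - of ρ' = (of ρ - of ρ' - a) + a := by abel
  rw [this]
  exact pencilSector.add_mem (relations_le_pencilSector hca) haS

/-- The crux from the registered stubs. -/
theorem pencilComplete_of_stubs :
    Summit.KontsevichZagierPeriods.KontsevichZagierPeriods.Theses.ZeroPortrait.PencilComplete :=
  PencilComplete_of stub_cubeNashNormalForm stub_cubicalPiLocalKernelModPencils stub_piCancellationModPencils

end Summit.KontsevichZagierPeriods.KontsevichZagierPeriods.Cruxes.PencilComplete.AyoubPiSplitLine
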